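import Literature.Probability.LatticeModels.DiscreteRectBoundaryTrace
import Literature.Probability.LatticeModels.CornerPermutation
import HarnessLib

/-!
# Boundary tracing of a discrete domain: the successor is a permutation of the external darts
(line `fk-anchor-transfer`, crux `IsingBoundaryRatio`, stmt-CriticalPhenomena-10650; first helper file of the
stub `windowRectPresentation_holds : WindowRectPresentation`)

Elementary bookkeeping for the boundary-tracing successor `DiscreteRect.succ E` of
`FKIsingTopologicalRectangleCrossing.lean` (CDH16 §2.1, "natural cyclic order on `∂Ω`"):

* coordinates of the four directions `DiscreteRect.dir` (`dir_succ_apply_*`; direction arithmetic from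
  `DiscreteRectBoundaryTrace.lean`, `Fin 4` arithmetic from `CornerPermutation.lean`);
* `succ_spec` — the four branches of `succ`, with the edges of `E` they use;
* `exists_pred` — `succ` has a two-sided inverse on external darts (the clockwise mirror rule), whence
  `succ_injOn` (that it maps external darts to external darts is `DiscreteRect.IsExtDart.succ` of
  `DiscreteExtremalLengthExternalArcsProofs.lean`);
* `exists_period` — the orbit of an external dart `d₀` is periodic, with a period `N > 0` within which the
  darts are pairwise distinct (pigeonhole on the finite set of external darts).

All statements are folklore bookkeeping; the tree's `DiscreteFaceBoundary.lean` does the same for the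
face-boundary walk of inner faces (`bsucc`, `bperiod`, `bwalk_injOn`), which is a different walk.
-/

noncomputable section

open scoped Classical
open Literature.Probability.LatticeModels Literature.Probability.LatticeModels.DiscreteRect

namespace Summit.CriticalPhenomena.SAWScalingLimit.Theorems.IsingBoundaryRatio

namespace WindowRect

/-! ### Arithmetic in `Fin 4` and the four directions -/

/-- `k - 1 = k + 3` in `Fin 4`. [folklore] -/
theorem fin4_sub_one (k : Fin 4) : k - 1 = k + 3 := by revert k; decide
/-- First coordinate of `dir (k + 1)`: a quarter turn, `dir (k+1) 0 = -(dir k 1)`. [folklore] -/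
theorem dir_succ_apply_zero (k : Fin 4) : dir (k + 1) 0 = -(dir k 1) := by
  fin_cases k <;> decide

/-- Second coordinate of `dir (k + 1)`: `dir (k+1) 1 = dir k 0`. [folklore] -/
theorem dir_succ_apply_one (k : Fin 4) : dir (k + 1) 1 = dir k 0 := by
  fin_cases k <;> decide

/-- The coordinates of `dir k` are `0` or `±1`, exactly one of them nonzero. [folklore] -/
theorem dir_apply_cases (k : Fin 4) :
    (dir k 0 = 1 ∧ dir k 1 = 0) ∨ (dir k 0 = 0 ∧ dir k 1 = 1) ∨ (dir k 0 = -1 ∧ dir k 1 = 0) ∨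
      (dir k 0 = 0 ∧ dir k 1 = -1) := by
  fin_cases k <;> decide

/-- `x + dir k` is a lattice neighbour of `x`. [folklore] -/
theorem zdGraph_adj_add_dir (x : Site 2) (k : Fin 4) : (zdGraph 2).Adj x (x + dir k) := by
  rw [Literature.Probability.Percolation.zdGraph_two_adj_iff]
  simp only [Pi.add_apply]
  rcases dir_apply_cases k with ⟨h0, h1⟩ | ⟨h0, h1⟩ | ⟨h0, h1⟩ | ⟨h0, h1⟩ <;> omega

/-- A lattice neighbour of `x` is `x + dir k` for some `k`. [folklore] -/
theorem exists_eq_add_dir_of_adj {x y : Site 2} (h : (zdGraph 2).Adj x y) : ∃ k : Fin 4, y = x + dir k := by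
  rw [Literature.Probability.Percolation.zdGraph_two_adj_iff] at h
  have e0 : dir 0 0 = 1 ∧ dir 0 1 = 0 := by decide
  have e1 : dir 1 0 = 0 ∧ dir 1 1 = 1 := by decide
  have e2 : dir 2 0 = -1 ∧ dir 2 1 = 0 := by decide
  have e3 : dir 3 0 = 0 ∧ dir 3 1 = -1 := by decide
  rcases h with ⟨h0, h1⟩ | ⟨h0, h1⟩ | ⟨h1, h0⟩ | ⟨h1, h0⟩
  · exact ⟨0, funext fun i => by fin_cases i <;> simp [Pi.add_apply, e0.1, e0.2] <;> omega⟩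
  · exact ⟨2, funext fun i => by fin_cases i <;> simp [Pi.add_apply, e2.1, e2.2] <;> omega⟩
  · exact ⟨1, funext fun i => by fin_cases i <;> simp [Pi.add_apply, e1.1, e1.2] <;> omega⟩
  · exact ⟨3, funext fun i => by fin_cases i <;> simp [Pi.add_apply, e3.1, e3.2] <;> omega⟩

/-! ### Vertices -/

/-- The near endpoint of an edge of `E` is a vertex of the domain. [folklore] -/
theorem mem_verts_of_mem_left {E : Finset (Sym2 (Site 2))} {x y : Site 2} (h : s(x, y) ∈ E) : x ∈ verts E :=
  mem_verts_of_mem (by rwa [Sym2.eq_swap] at h)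

/-! ### The four branches of the successor -/

/-- **The four branches of `succ`.** Writing `y = x + dir (k+1)`, `y' = y + dir k`, `x' = x + dir k`:
either the edge `x y` is missing and `succ (x, k) = (x, k+1)`; or `x y ∈ E`, `y y'` missing and
`succ = (y, k)`; or `x y, y y' ∈ E`, `y' x'` missing and `succ = (y', k+3)`; or `x y, y y', y' x' ∈ E` and
`succ = (x', k+2)`. [folklore] -/
theorem succ_spec (E : Finset (Sym2 (Site 2))) (x : Site 2) (k : Fin 4) :
    (s(x, x + dir (k + 1)) ∉ E ∧ succ E (x, k) = (x, k + 1)) ∨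
    (s(x, x + dir (k + 1)) ∈ E ∧ s(x + dir (k + 1), x + dir (k + 1) + dir k) ∉ E ∧
      succ E (x, k) = (x + dir (k + 1), k)) ∨
    (s(x, x + dir (k + 1)) ∈ E ∧ s(x + dir (k + 1), x + dir (k + 1) + dir k) ∈ E ∧
      s(x + dir (k + 1) + dir k, x + dir k) ∉ E ∧ succ E (x, k) = (x + dir (k + 1) + dir k, k + 3)) ∨
    (s(x, x + dir (k + 1)) ∈ E ∧ s(x + dir (k + 1), x + dir (k + 1) + dir k) ∈ E ∧
      s(x + dir (k + 1) + dir k, x + dir k) ∈ E ∧ succ E (x, k) = (x + dir k, k + 2)) := by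
  have h3 : k - 1 = k + 3 := fin4_sub_one k
  have h2 : k - 2 = k + 2 := by revert k; decide
  have hv : x + dir (k + 1) + dir k + dir (k + 3) = x + dir k := by rw [dir_add_three]; abel
  by_cases c1 : s(x, x + dir (k + 1)) ∈ E
  · by_cases c2 : s(x + dir (k + 1), x + dir (k + 1) + dir k) ∈ E
    · by_cases c3 : s(x + dir (k + 1) + dir k, x + dir k) ∈ E
      · refine Or.inr (Or.inr (Or.inr ⟨c1, c2, c3, ?_⟩))
        simp only [succ, c1, not_true_eq_false, if_false, c2, h3, hv, c3, h2]
      · refine Or.inr (Or.inr (Or.inl ⟨c1, c2, c3, ?_⟩))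
        simp only [succ, c1, not_true_eq_false, if_false, c2, h3, hv, c3, not_false_eq_true, if_true]
    · exact Or.inr (Or.inl ⟨c1, c2, by simp only [succ, c1, not_true_eq_false, if_false, c2,
        not_false_eq_true, if_true]⟩)
  · exact Or.inl ⟨c1, by simp only [succ, c1, not_false_eq_true, if_true]⟩

/-- **The successor has a two-sided inverse on external darts** (the clockwise mirror of its
definition). [folklore] -/
theorem exists_pred (E : Finset (Sym2 (Site 2))) :
    ∃ pred : Site 2 × Fin 4 → Site 2 × Fin 4,
      (∀ d, IsExtDart E d → pred (succ E d) = d) ∧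
      (∀ d, IsExtDart E d → IsExtDart E (pred d) ∧ succ E (pred d) = d) := by
  refine ⟨fun d =>
    if s(d.1, d.1 + dir (d.2 + 3)) ∉ E then (d.1, d.2 + 3)
    else if s(d.1 + dir (d.2 + 3), d.1 + dir (d.2 + 3) + dir d.2) ∉ E then (d.1 + dir (d.2 + 3), d.2)
    else if s(d.1 + dir (d.2 + 3) + dir d.2, d.1 + dir d.2) ∉ E then (d.1 + dir (d.2 + 3) + dir d.2, d.2 + 1)
    else (d.1 + dir d.2, d.2 + 2), ?_, ?_⟩
  · rintro ⟨x, k⟩ hd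
    rcases succ_spec E x k with ⟨h1, he⟩ | ⟨h1, h2, he⟩ | ⟨h1, h2, h3, he⟩ | ⟨h1, h2, h3, he⟩ <;>
      rw [he] <;> dsimp only
    · rw [fin4_add_one_add_three, if_pos hd.2]
    · have a1 : s(x + dir (k + 1), x + dir (k + 1) + dir (k + 3)) ∈ E := by
        rwa [dir_add_three, ← sub_eq_add_neg, add_sub_cancel_right, Sym2.eq_swap]
      have a2 : x + dir (k + 1) + dir (k + 3) = x := by rw [dir_add_three]; abel
      rw [if_neg (not_not.2 a1), a2, if_pos hd.2]
    · have a1 : s(x + dir (k + 1) + dir k, x + dir (k + 1) + dir k + dir (k + 3 + 3)) ∈ E := by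
        rwa [fin4_add_three_add_three, dir_add_two, ← sub_eq_add_neg, add_sub_cancel_right, Sym2.eq_swap]
      have a2 : x + dir (k + 1) + dir k + dir (k + 3 + 3) = x + dir (k + 1) := by
        rw [fin4_add_three_add_three, dir_add_two]; abel
      have a3 : s(x + dir (k + 1), x + dir (k + 1) + dir (k + 3)) ∈ E := by
        rwa [dir_add_three, ← sub_eq_add_neg, add_sub_cancel_right, Sym2.eq_swap]
      have a4 : x + dir (k + 1) + dir (k + 3) = x := by rw [dir_add_three]; abel
      have a5 : x + dir (k + 1) + dir k + dir (k + 3) = x + dir k := by rw [dir_add_three]; abel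
      rw [if_neg (not_not.2 a1), a2, if_neg (not_not.2 a3), a4, a5, if_pos hd.2, fin4_add_three_add_one]
    · have a1 : s(x + dir k, x + dir k + dir (k + 2 + 3)) ∈ E := by
        rw [fin4_add_two_add_three, Sym2.eq_swap]; convert h3 using 2; abel
      have a2 : x + dir k + dir (k + 2 + 3) = x + dir (k + 1) + dir k := by rw [fin4_add_two_add_three]; abel
      have a3 : s(x + dir (k + 1) + dir k, x + dir (k + 1) + dir k + dir (k + 2)) ∈ E := by
        rw [dir_add_two, ← sub_eq_add_neg, add_sub_cancel_right, Sym2.eq_swap]; exact h2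
      have a4 : x + dir (k + 1) + dir k + dir (k + 2) = x + dir (k + 1) := by rw [dir_add_two]; abel
      have a5 : x + dir k + dir (k + 2) = x := by rw [dir_add_two]; abel
      have a6 : s(x + dir (k + 1), x) ∈ E := by rw [Sym2.eq_swap]; exact h1
      rw [if_neg (not_not.2 a1), a2, if_neg (not_not.2 a3), a4, a5, if_neg (not_not.2 a6), fin4_add_two_add_two']
  · rintro ⟨x, k⟩ hd
    dsimp only
    have ew : x + dir (k + 3) + dir (k + 1) = x := by rw [dir_add_three]; abel
    have ew' : x + dir (k + 3) + dir k + dir (k + 1) = x + dir k := by rw [dir_add_three]; abel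
    by_cases c1 : s(x, x + dir (k + 3)) ∈ E
    · rw [if_neg (not_not.2 c1)]
      by_cases c2 : s(x + dir (k + 3), x + dir (k + 3) + dir k) ∈ E
      · rw [if_neg (not_not.2 c2)]
        by_cases c3 : s(x + dir (k + 3) + dir k, x + dir k) ∈ E
        · rw [if_neg (not_not.2 c3)]
          refine ⟨⟨mem_verts_of_mem c3, ?_⟩, ?_⟩
          · show s(x + dir k, x + dir k + dir (k + 2)) ∉ E
            rw [dir_add_two, ← sub_eq_add_neg, add_sub_cancel_right, Sym2.eq_swap]; exact hd.2
          · rcases succ_spec E (x + dir k) (k + 2) with ⟨b1, -⟩ | ⟨-, b2, -⟩ | ⟨-, -, b3, -⟩ | ⟨-, -, -, he⟩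
            · have e1 : x + dir k + dir (k + 3) = x + dir (k + 3) + dir k := by abel
              rw [fin4_add_two_add_one, e1, Sym2.eq_swap] at b1
              exact absurd c3 b1
            · have e1 : x + dir k + dir (k + 3) = x + dir (k + 3) + dir k := by abel
              have e2 : x + dir (k + 3) + dir k + -dir k = x + dir (k + 3) := by abel
              rw [fin4_add_two_add_one, dir_add_two, e1, e2, Sym2.eq_swap] at b2
              exact absurd c2 b2
            · have e1 : x + dir k + dir (k + 3) = x + dir (k + 3) + dir k := by abel
              have e2 : x + dir (k + 3) + dir k + -dir k = x + dir (k + 3) := by abel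
              have e3 : x + dir k + -dir k = x := by abel
              rw [fin4_add_two_add_one, dir_add_two, e1, e2, e3, Sym2.eq_swap] at b3
              exact absurd c1 b3
            · rw [he, fin4_add_two_add_two', dir_add_two, ← sub_eq_add_neg, add_sub_cancel_right]
        · rw [if_pos c3]
          refine ⟨⟨mem_verts_of_mem c2, by rwa [ew']⟩, ?_⟩
          rcases succ_spec E (x + dir (k + 3) + dir k) (k + 1) with
            ⟨b1, -⟩ | ⟨-, b2, -⟩ | ⟨-, -, -, he⟩ | ⟨-, -, b3, -⟩
          · rw [fin4_add_one_add_one, dir_add_two, ← sub_eq_add_neg, add_sub_cancel_right, Sym2.eq_swap] at b1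
            exact absurd c2 b1
          · rw [fin4_add_one_add_one, dir_add_two, ← sub_eq_add_neg, add_sub_cancel_right, ew, Sym2.eq_swap] at b2
            exact absurd c1 b2
          · rw [he, fin4_add_one_add_one, dir_add_two, ← sub_eq_add_neg, add_sub_cancel_right, ew, fin4_add_one_add_three]
          · rw [fin4_add_one_add_one, dir_add_two, ← sub_eq_add_neg, add_sub_cancel_right, ew, ew'] at b3
            exact absurd b3 hd.2
      · rw [if_pos c2]
        refine ⟨⟨mem_verts_of_mem c1, c2⟩, ?_⟩
        rcases succ_spec E (x + dir (k + 3)) k with ⟨b1, -⟩ | ⟨-, -, he⟩ | ⟨-, b2, -⟩ | ⟨-, b2, -⟩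
        · rw [ew, Sym2.eq_swap] at b1; exact absurd c1 b1
        · rw [he, ew]
        · rw [ew] at b2; exact absurd b2 hd.2
        · rw [ew] at b2; exact absurd b2 hd.2
    · rw [if_pos c1]
      refine ⟨⟨hd.1, c1⟩, ?_⟩
      rcases succ_spec E x (k + 3) with ⟨-, he⟩ | ⟨b, -⟩ | ⟨b, -⟩ | ⟨b, -⟩
      · rw [he, fin4_add_three_add_one]
      all_goals rw [fin4_add_three_add_one] at b; exact absurd b hd.2

/-- `succ` is injective on external darts. [folklore] -/
theorem succ_injOn (E : Finset (Sym2 (Site 2))) : Set.InjOn (succ E) {d | IsExtDart E d} := by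
  obtain ⟨pred, hps, -⟩ := exists_pred E
  intro d hd d' hd' h
  rw [← hps d hd, ← hps d' hd', h]

/-- `succ` is surjective onto the external darts, from external darts. [folklore] -/
theorem exists_succ_eq {E : Finset (Sym2 (Site 2))} {d : Site 2 × Fin 4} (hd : IsExtDart E d) :
    ∃ d', IsExtDart E d' ∧ succ E d' = d := by
  obtain ⟨pred, -, hsp⟩ := exists_pred E
  exact ⟨pred d, (hsp d hd).1, (hsp d hd).2⟩

/-- Cancellation of a common number of steps along an orbit of external darts. [folklore] -/
theorem iterate_eq_of_iterate_add_eq {E : Finset (Sym2 (Site 2))} {d₀ : Site 2 × Fin 4} (hd : IsExtDart E d₀)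
    {i j : ℕ} (m : ℕ) (h : (succ E)^[i + m] d₀ = (succ E)^[j + m] d₀) : (succ E)^[i] d₀ = (succ E)^[j] d₀ := by
  induction m with
  | zero => simpa using h
  | succ m ih =>
    apply ih
    rw [← add_assoc, ← add_assoc, Function.iterate_succ_apply', Function.iterate_succ_apply'] at h
    exact succ_injOn E (hd.iterate _) (hd.iterate _) h

/-- The external darts form a finite set. [folklore] -/
theorem finite_isExtDart (E : Finset (Sym2 (Site 2))) : {d : Site 2 × Fin 4 | IsExtDart E d}.Finite :=
  ((verts E).finite_toSet.prod Set.finite_univ).subset fun _ hd => ⟨hd.1, Set.mem_univ _⟩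

/-- **Periodicity of the boundary-tracing orbit.** From an external dart `d₀` the successor orbit is
periodic with some period `N > 0`, and the darts at positions `0, …, N-1` are pairwise distinct.
[folklore] -/
theorem exists_period {E : Finset (Sym2 (Site 2))} {d₀ : Site 2 × Fin 4} (hd : IsExtDart E d₀) :
    ∃ N, 0 < N ∧ (succ E)^[N] d₀ = d₀ ∧
      ∀ i j, i < N → j < N → (succ E)^[i] d₀ = (succ E)^[j] d₀ → i = j := by
  have hex : ∃ P, 0 < P ∧ (succ E)^[P] d₀ = d₀ := by
    obtain ⟨i, j, hij, h⟩ := (finite_isExtDart E).exists_lt_map_eq_of_forall_mem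
      (f := fun n => (succ E)^[n] d₀) (fun n => hd.iterate n)
    refine ⟨j - i, by omega, ?_⟩
    have := iterate_eq_of_iterate_add_eq hd (i := 0) (j := j - i) i
      (by rwa [zero_add, Nat.sub_add_cancel hij.le])
    exact this.symm
  refine ⟨Nat.find hex, (Nat.find_spec hex).1, (Nat.find_spec hex).2, fun i j hi hj h => ?_⟩
  by_contra hne
  wlog hij : i < j generalizing i j
  · exact this j i hj hi h.symm (Ne.symm hne) (by omega)
  have h' : (succ E)^[0 + i] d₀ = (succ E)^[(j - i) + i] d₀ := by
    rwa [zero_add, Nat.sub_add_cancel hij.le]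
  have := iterate_eq_of_iterate_add_eq hd i h'
  exact Nat.find_min hex (m := j - i) (by omega) ⟨by omega, this.symm⟩

/-- A periodic orbit repeats after any number of periods. [folklore] -/
theorem iterate_add_mul_eq {α : Type*} {f : α → α} {a : α} {N : ℕ} (h : f^[N] a = a) (n m : ℕ) :
    f^[n + m * N] a = f^[n] a := by
  induction m with
  | zero => simp
  | succ m ih => rw [add_mul, one_mul, ← add_assoc, Function.iterate_add_apply, h, ih]

/-- A periodic orbit only depends on the position modulo the period. [folklore] -/
theorem iterate_mod_eq {α : Type*} {f : α → α} {a : α} {N : ℕ} (h : f^[N] a = a) (n : ℕ) :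
    f^[n % N] a = f^[n] a := by
  conv_rhs => rw [← Nat.mod_add_div n N, mul_comm]
  exact (iterate_add_mul_eq h _ _).symm

end WindowRect

/-- **Periodicity of the boundary-tracing orbit**, closed form (registered sub-goal of
stmt-CriticalPhenomena-10650). [folklore] -/
theorem discreteRect_exists_period : ∀ {E : Finset (Sym2 (Site 2))} {d₀ : Site 2 × Fin 4}, DiscreteRect.IsExtDart E d₀ → ∃ N, 0 < N ∧ (DiscreteRect.succ E)^[N] d₀ = d₀ ∧ ∀ i j, i < N → j < N → (DiscreteRect.succ E)^[i] d₀ = (DiscreteRect.succ E)^[j] d₀ → i = j :=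
  fun hd => WindowRect.exists_period hd

end Summit.CriticalPhenomena.SAWScalingLimit.Theorems.IsingBoundaryRatio

end
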